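import Summits.CriticalPhenomena.PercolationContinuityZ3.Theorems.PercNearOneGluingNoHeavyLowerTailSahiTwoLevelMonomialFace
import Mathlib.MeasureTheory.Measure.Real
import Mathlib.Tactic.Linarith
import Mathlib.Tactic.Positivity
import Mathlib.Tactic.Ring
import HarnessLib

/-!
# A GENERIC TYPE-CERTIFICATE CHECKER for the two-level top law: monomial faces by `decide`

Support file of the one-cut programme (crux `NoHeavyLowerTail`, stmt-CriticalPhenomena-4575; master-family line P2 = Sahi's algebraic route,
seat `prim-masterthm-p2` gen 22; memo `run/shared/lean/prim/prim-masterthm/FROM-prim-masterthm-p2-g22-SATURATION.md` §5, §8).  Definitions (computable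
combinatorics on the 27 types + a trilinear form), no sorry; axioms standard.

SETTING.  For a nested pair `H_i ⊆ G_i` every point of the cube has a TYPE `t ∈ Ty = Fin 3 × Fin 3 × Fin 3` (`0` outside `G_i`, `1` in the shell, `2` in `H_i`);
`a t` = mass of the type.  A TERM is an integer coefficient with three type predicates; a list of terms `L` denotes both a cubic form in the type
masses, `evalL a L = Σ_k c_k · m(x_k) m(y_k) m(z_k)` (`m(P) = Σ_{t : P t} a t`), and an integer coefficient table `coefOf L t u v`.  `tpTerms` is the list of
the twelve terms of `T⁺ − E_3(G)` (compact form, homogenised with `m(true) = 1`).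
* `evalL_eq_TS` — `evalL a L = Σ_{t,u,v} coefOf L t u v · a_t a_u a_v` (trilinear bookkeeping);
* `TS_symOf` — symmetrising the table does not change the form (times `6`);
* `check L F` — the DECIDABLE test "every ordered triple of types outside the forbidden set `F` has symmetrised coefficient `≥ 0`";
  `evalL_nonneg_of_check` — if it passes and the forbidden types carry no mass, `0 ≤ evalL a L`;
* `topForm_sub_sahiE3_eq_evalL` — THE BRIDGE: for a configuration, `T⁺(G,H) − E_3(G) = evalL a tpTerms` with `a` the type masses;
* **`sahiE3_le_topForm_of_check`** — for ANY forbidden-type predicate `F` with `check tpTerms F = true` (by `decide`, ≈ 20 000 cases) and every forbidden type empty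
  in the configuration: `E_3(G) ≤ T⁺(G,H)`.  Every MONOMIAL FACE of the programme (memo §5) is an instance; e.g. `…MonomialFace` / `…MonomialFaceB` are
  `F = forbCoSunflower` / `F = forbAbsorbingBottoms` (`check_coSunflower`, `check_absorbingBottoms` by `decide`; the face theorems themselves are the
  already-landed `sahiE3_le_topForm_of_coSunflowerTops` / `sahiE3_le_topForm_of_absorbingBottoms`, not restated here).
HONEST LABEL: Kahn's Conjecture 5 / `SahiTwoLevelPlus` OPEN; this file is infrastructure (certificate checking), not a new inequality. [this work]
-/

noncomputable section

open scoped Classical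

namespace Summit.CriticalPhenomena.PercolationContinuityZ3.Theorems

namespace SahiTwoLevelVariational

namespace TypeCert

open Finset Function MeasureTheory
open Literature.Combinatorics.Sahi2008
open Literature.Probability.LatticeModels (prodBernoulli prodBernoulli_harris sahiE3 sahiE3_def)

/-! ### 1. Types, predicates, terms, coefficient tables (computable) -/

/-- The 27 types. [this work] -/
abbrev Ty := Fin 3 × Fin 3 × Fin 3

/-- Slot projection of a type. [this work] -/
def proj (i : Fin 3) (t : Ty) : Fin 3 := if i = 0 then t.1 else if i = 1 then t.2.1 else t.2.2

/-- Type predicate of the top `G_i` (`level ≠ 0`). [this work] -/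
def pG (i : Fin 3) : Ty → Bool := fun t => decide (proj i t ≠ 0)
/-- Type predicate of the bottom `H_i` (`level = 2`). [this work] -/
def pH (i : Fin 3) : Ty → Bool := fun t => decide (proj i t = 2)
/-- Conjunction of type predicates. [this work] -/
def pAnd (P Q : Ty → Bool) : Ty → Bool := fun t => P t && Q t
/-- The trivially true type predicate (total mass). [this work] -/
def pTrue : Ty → Bool := fun _ => true

/-- `0/1` indicator of a type predicate, as an integer. [this work] -/
def ind (P : Ty → Bool) (t : Ty) : ℤ := if P t then 1 else 0

/-- A term: coefficient and three type predicates (one per factor). [this work] -/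
structure Tm where
  /-- coefficient -/
  c : ℤ
  /-- first factor's predicate -/
  x : Ty → Bool
  /-- second factor's predicate -/
  y : Ty → Bool
  /-- third factor's predicate -/
  z : Ty → Bool

/-- Ordered coefficient table of a term. [this work] -/
def Tm.coef (k : Tm) (t u v : Ty) : ℤ := k.c * ind k.x t * ind k.y u * ind k.z v

/-- Ordered coefficient table of a list of terms. [this work] -/
def coefOf : List Tm → Ty → Ty → Ty → ℤ
  | [], _, _, _ => 0
  | k :: L, t, u, v => k.coef t u v + coefOf L t u v

/-- Symmetrised coefficient table (sum over the six orderings). [this work] -/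
def symOf (L : List Tm) (t u v : Ty) : ℤ :=
  coefOf L t u v + coefOf L t v u + coefOf L u t v + coefOf L u v t + coefOf L v t u + coefOf L v u t

/-- All 27 types as a list. [this work] -/
def allTy : List Ty := List.finRange 3 ×ˢ (List.finRange 3 ×ˢ List.finRange 3)

/-- THE CHECK: every ordered triple of types avoiding the forbidden predicate `F` has nonnegative symmetrised coefficient. [this work] -/
def check (L : List Tm) (F : Ty → Bool) : Bool :=
  allTy.all fun t => allTy.all fun u => allTy.all fun v => F t || F u || F v || decide (0 ≤ symOf L t u v)

/-- The twelve terms of `T⁺ − E_3(G)` (compact form of `T⁺` minus `E_3` of the tops, homogenised with the total mass). [this work] -/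
def tpTerms : List Tm :=
  [⟨2, pAnd (pH 0) (pAnd (pH 1) (pH 2)), pTrue, pTrue⟩,
   ⟨-1, pG 0, pAnd (pH 1) (pH 2), pTrue⟩, ⟨-1, pG 1, pAnd (pH 0) (pH 2), pTrue⟩, ⟨-1, pG 2, pAnd (pH 0) (pH 1), pTrue⟩,
   ⟨-1, pH 0, pAnd (pG 1) (pG 2), pTrue⟩, ⟨-1, pH 1, pAnd (pG 0) (pG 2), pTrue⟩, ⟨-1, pH 2, pAnd (pG 0) (pG 1), pTrue⟩,
   ⟨1, pH 0, pG 1, pG 2⟩, ⟨1, pH 1, pG 0, pG 2⟩, ⟨1, pH 2, pG 0, pG 1⟩,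
   ⟨1, pG 0, pAnd (pG 1) (pG 2), pTrue⟩, ⟨1, pG 1, pAnd (pG 0) (pG 2), pTrue⟩, ⟨1, pG 2, pAnd (pG 0) (pG 1), pTrue⟩,
   ⟨-2, pG 0, pG 1, pG 2⟩]

/-- Every type lies in `allTy`. [this work] -/
theorem mem_allTy (t : Ty) : t ∈ allTy := by
  obtain ⟨t1, t2, t3⟩ := t
  simp [allTy, List.mem_product, List.mem_finRange]

/-- Soundness of the check, pointwise. [this work] -/
theorem check_sound {L : List Tm} {F : Ty → Bool} (h : check L F = true) (t u v : Ty) :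
    F t = true ∨ F u = true ∨ F v = true ∨ 0 ≤ symOf L t u v := by
  unfold check at h
  rw [List.all_eq_true] at h
  have h1 := h t (mem_allTy t); rw [List.all_eq_true] at h1
  have h2 := h1 u (mem_allTy u); rw [List.all_eq_true] at h2
  have h3 := h2 v (mem_allTy v)
  simp only [Bool.or_eq_true, decide_eq_true_eq] at h3
  tauto

/-! ### 2. The trilinear form of a coefficient table -/

section Algebra

variable (a : Ty → ℝ)

/-- Mass of a type predicate. [this work] -/
def msum (P : Ty → Bool) : ℝ := ∑ t, (ind P t : ℝ) * a t

/-- Value of a term: coefficient times the product of the three masses. [this work] -/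
def evalTm (k : Tm) : ℝ := (k.c : ℝ) * (msum a k.x * msum a k.y * msum a k.z)

/-- Value of a list of terms. [this work] -/
def evalL : List Tm → ℝ
  | [] => 0
  | k :: L => evalTm a k + evalL L

/-- The trilinear form of an integer coefficient table. [this work] -/
def TS (w : Ty → Ty → Ty → ℤ) : ℝ := ∑ t, ∑ u, ∑ v, (w t u v : ℝ) * (a t * a u * a v)

/-- Linearity of `TS` in the table. [this work] -/
theorem TS_add (w₁ w₂ : Ty → Ty → Ty → ℤ) :
    TS a (fun t u v => w₁ t u v + w₂ t u v) = TS a w₁ + TS a w₂ := by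
  simp only [TS, Int.cast_add, add_mul, Finset.sum_add_distrib]

/-- Distributing a product of three finite sums. [folklore] -/
theorem tri3 (f g h : Ty → ℝ) : (∑ t, f t) * (∑ u, g u) * (∑ v, h v) = ∑ t, ∑ u, ∑ v, f t * g u * h v := by
  rw [Finset.sum_mul_sum, Finset.sum_mul]
  refine Finset.sum_congr rfl fun t _ => ?_
  rw [Finset.sum_mul]
  refine Finset.sum_congr rfl fun u _ => ?_
  rw [Finset.mul_sum]

/-- A product of three masked sums is the trilinear form of the product table. [this work] -/
theorem evalTm_eq_TS (k : Tm) : evalTm a k = TS a k.coef := by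
  unfold evalTm msum TS Tm.coef
  rw [tri3, Finset.mul_sum]
  refine Finset.sum_congr rfl fun t _ => ?_
  rw [Finset.mul_sum]
  refine Finset.sum_congr rfl fun u _ => ?_
  rw [Finset.mul_sum]
  refine Finset.sum_congr rfl fun v _ => ?_
  push_cast
  ring

/-- A list of terms evaluates to the trilinear form of its coefficient table. [this work] -/
theorem evalL_eq_TS (L : List Tm) : evalL a L = TS a (coefOf L) := by
  induction L with
  | nil => simp [evalL, TS, coefOf]
  | cons k L ih =>
    simp only [evalL, ih, evalTm_eq_TS]
    have : (coefOf (k :: L)) = fun t u v => k.coef t u v + coefOf L t u v := by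
      funext t u v; rfl
    rw [this, TS_add]

/-- Swapping the first two arguments of the table does not change the form. [this work] -/
theorem TS_swap12 (w : Ty → Ty → Ty → ℤ) : TS a (fun t u v => w u t v) = TS a w := by
  simp only [TS]
  rw [Finset.sum_comm]
  refine Finset.sum_congr rfl fun t _ => Finset.sum_congr rfl fun u _ => Finset.sum_congr rfl fun v _ => ?_
  ring

/-- Swapping the last two arguments of the table does not change the form. [this work] -/
theorem TS_swap23 (w : Ty → Ty → Ty → ℤ) : TS a (fun t u v => w t v u) = TS a w := by
  simp only [TS]
  refine Finset.sum_congr rfl fun t _ => ?_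
  rw [Finset.sum_comm]
  refine Finset.sum_congr rfl fun u _ => Finset.sum_congr rfl fun v _ => ?_
  ring

/-- The symmetrised table gives six times the form. [this work] -/
theorem TS_symOf (L : List Tm) : TS a (symOf L) = 6 * TS a (coefOf L) := by
  have e1 : TS a (fun t u v => coefOf L t v u) = TS a (coefOf L) := TS_swap23 a (coefOf L)
  have e2 : TS a (fun t u v => coefOf L u t v) = TS a (coefOf L) := TS_swap12 a (coefOf L)
  have e3 : TS a (fun t u v => coefOf L u v t) = TS a (coefOf L) :=
    (TS_swap12 a (fun t u v => coefOf L t v u)).trans (TS_swap23 a (coefOf L))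
  have e4 : TS a (fun t u v => coefOf L v t u) = TS a (coefOf L) :=
    (TS_swap23 a (fun t u v => coefOf L u t v)).trans (TS_swap12 a (coefOf L))
  have e5 : TS a (fun t u v => coefOf L v u t) = TS a (coefOf L) :=
    (TS_swap12 a (fun t u v => coefOf L v t u)).trans e4
  have hs : (symOf L) = fun t u v => ((((coefOf L t u v + coefOf L t v u) + coefOf L u t v) + coefOf L u v t) + coefOf L v t u) + coefOf L v u t := by
    funext t u v; rfl
  rw [hs, TS_add, TS_add, TS_add, TS_add, TS_add]
  rw [show (TS a fun t u v => coefOf L t u v) = TS a (coefOf L) from rfl, e1, e2, e3, e4, e5]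
  ring

/-- **Positivity from the check**: if `check L F` passes, the forbidden types carry no mass and all masses are nonnegative, then `0 ≤ evalL a L`. [this work] -/
theorem evalL_nonneg_of_check (L : List Tm) (F : Ty → Bool) (hchk : check L F = true) (ha : ∀ t, 0 ≤ a t)
    (hF : ∀ t, F t = true → a t = 0) : 0 ≤ evalL a L := by
  have hsym : 0 ≤ TS a (symOf L) := by
    unfold TS
    refine Finset.sum_nonneg fun t _ => Finset.sum_nonneg fun u _ => Finset.sum_nonneg fun v _ => ?_
    rcases check_sound hchk t u v with h | h | h | h
    · rw [hF t h]; simp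
    · rw [hF u h]; simp
    · rw [hF v h]; simp
    · exact mul_nonneg (by exact_mod_cast h) (mul_nonneg (mul_nonneg (ha t) (ha u)) (ha v))
  rw [evalL_eq_TS]
  have h6 := TS_symOf a L
  linarith

end Algebra

/-! ### 3. The bridge: `T⁺ − E_3(G)` is the value of `tpTerms` at the type masses -/

variable {κ : Type} [Fintype κ]

/-- The level of a point in slot `i`: `2` in `H_i`, `1` in `G_i ∖ H_i`, `0` outside. [this work] -/
def lvl (G H : Fin 3 → Set (Set κ)) (i : Fin 3) (ω : Set κ) : Fin 3 := if ω ∈ H i then 2 else if ω ∈ G i then 1 else 0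

/-- The type of a point. [this work] -/
def typeOf (G H : Fin 3 → Set (Set κ)) (ω : Set κ) : Ty := (lvl G H 0 ω, lvl G H 1 ω, lvl G H 2 ω)

/-- The type masses of a configuration. [this work] -/
def tmass (q : κ → unitInterval) (G H : Fin 3 → Set (Set κ)) (t : Ty) : ℝ := (prodBernoulli q).real (typeOf G H ⁻¹' {t})

omit [Fintype κ] in
/-- Projections of the type. [this work] -/
theorem proj_typeOf (G H : Fin 3 → Set (Set κ)) (i : Fin 3) (ω : Set κ) : proj i (typeOf G H ω) = lvl G H i ω := by
  fin_cases i <;> rfl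

omit [Fintype κ] in
/-- Membership in a top in terms of the level. [this work] -/
theorem mem_G_iff (G H : Fin 3 → Set (Set κ)) (hHG : ∀ i, H i ⊆ G i) (i : Fin 3) (ω : Set κ) :
    ω ∈ G i ↔ lvl G H i ω ≠ 0 := by
  by_cases h1 : ω ∈ H i
  · have h2 : ω ∈ G i := hHG i h1
    simp [lvl, h1, h2]
  · by_cases h2 : ω ∈ G i
    · simp [lvl, h1, h2]
    · simp [lvl, h1, h2]

omit [Fintype κ] in
/-- Membership in a bottom in terms of the level. [this work] -/
theorem mem_H_iff (G H : Fin 3 → Set (Set κ)) (i : Fin 3) (ω : Set κ) : ω ∈ H i ↔ lvl G H i ω = 2 := by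
  by_cases h1 : ω ∈ H i
  · simp [lvl, h1]
  · by_cases h2 : ω ∈ G i
    · simp [lvl, h1, h2]
    · simp [lvl, h1, h2]

/-- The mass of a type predicate is the measure of the corresponding event. [this work] -/
theorem msum_eq_measure (q : κ → unitInterval) (G H : Fin 3 → Set (Set κ)) (P : Ty → Bool) (E : Set (Set κ))
    (hE : ∀ ω, ω ∈ E ↔ P (typeOf G H ω) = true) :
    msum (tmass q G H) P = (prodBernoulli q).real E := by
  have hEq : E = typeOf G H ⁻¹' ↑(Finset.univ.filter fun t => P t = true) := by
    ext ω; simp [hE]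
  rw [hEq, ← sum_measureReal_preimage_singleton _ (fun y _ => MeasurableSet.of_discrete), Finset.sum_filter]
  unfold msum tmass ind
  refine Finset.sum_congr rfl fun t _ => ?_
  by_cases h : P t = true
  · simp [h]
  · simp [h]

/-- **THE BRIDGE**: `T⁺(G,H) − E_3(G) = evalL (type masses) tpTerms`. [this work] -/
theorem topForm_sub_sahiE3_eq_evalL (q : κ → unitInterval) (G H : Fin 3 → Set (Set κ)) (hHG : ∀ i, H i ⊆ G i) :
    topForm q G H - sahiE3 (prodBernoulli q) (G 0) (G 1) (G 2) = evalL (tmass q G H) tpTerms := by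
  have mG : ∀ i, msum (tmass q G H) (pG i) = (prodBernoulli q).real (G i) := fun i =>
    msum_eq_measure q G H _ _ fun ω => by rw [mem_G_iff G H hHG]; simp [pG, proj_typeOf]
  have mH : ∀ i, msum (tmass q G H) (pH i) = (prodBernoulli q).real (H i) := fun i =>
    msum_eq_measure q G H _ _ fun ω => by rw [mem_H_iff G H]; simp [pH, proj_typeOf]
  have mGG : ∀ i j, msum (tmass q G H) (pAnd (pG i) (pG j)) = (prodBernoulli q).real (G i ∩ G j) := fun i j =>
    msum_eq_measure q G H _ _ fun ω => by
      rw [Set.mem_inter_iff, mem_G_iff G H hHG, mem_G_iff G H hHG]; simp [pAnd, pG, proj_typeOf]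
  have mHH : ∀ i j, msum (tmass q G H) (pAnd (pH i) (pH j)) = (prodBernoulli q).real (H i ∩ H j) := fun i j =>
    msum_eq_measure q G H _ _ fun ω => by
      rw [Set.mem_inter_iff, mem_H_iff G H, mem_H_iff G H]; simp [pAnd, pH, proj_typeOf]
  have mHHH : msum (tmass q G H) (pAnd (pH 0) (pAnd (pH 1) (pH 2))) = (prodBernoulli q).real (H 0 ∩ H 1 ∩ H 2) :=
    msum_eq_measure q G H _ _ fun ω => by
      rw [Set.mem_inter_iff, Set.mem_inter_iff, mem_H_iff G H, mem_H_iff G H, mem_H_iff G H]; simp [pAnd, pH, proj_typeOf, and_assoc]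
  have mT : msum (tmass q G H) pTrue = 1 := by
    rw [msum_eq_measure q G H pTrue Set.univ (fun ω => by simp [pTrue]), probReal_univ]
  simp only [evalL, tpTerms, evalTm, mG, mH, mGG, mHH, mHHH, mT]
  rw [topForm_eq_compact, sahiE3_def]
  push_cast
  ring

/-! ### 4. Faces by `decide` -/

/-- **GENERIC MONOMIAL FACE.**  If the decidable check passes for the forbidden-type predicate `F` and no point of the configuration has a forbidden type,
then `E_3(μ_q; G) ≤ T⁺(G,H)`. [this work] -/
theorem sahiE3_le_topForm_of_check (q : κ → unitInterval) (G H : Fin 3 → Set (Set κ)) (hHG : ∀ i, H i ⊆ G i)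
    (F : Ty → Bool) (hchk : check tpTerms F = true) (hF : ∀ ω, F (typeOf G H ω) = false) :
    sahiE3 (prodBernoulli q) (G 0) (G 1) (G 2) ≤ topForm q G H := by
  have h := evalL_nonneg_of_check (tmass q G H) tpTerms F hchk (fun t => measureReal_nonneg) (fun t ht => by
    have : typeOf G H ⁻¹' {t} = ∅ := by
      ext ω; simp only [Set.mem_preimage, Set.mem_singleton_iff, Set.mem_empty_iff_false, iff_false]
      intro hω; have := hF ω; rw [hω, ht] at this; exact Bool.noConfusion this
    simp [tmass, this])
  rw [← topForm_sub_sahiE3_eq_evalL q G H hHG] at h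
  linarith

/-- Forbidden types of the co-sunflower-tops face (`…MonomialFace`). [this work] -/
def forbCoSunflower : Ty → Bool := fun t =>
  t ∈ [((0 : Fin 3), (0 : Fin 3), (1 : Fin 3)), (0, 0, 2), (0, 1, 0), (0, 2, 0), (0, 2, 2), (1, 0, 0), (2, 0, 0), (2, 0, 2), (2, 2, 0)]

/-- The co-sunflower-tops face passes the check. [this work] -/
theorem check_coSunflower : check tpTerms forbCoSunflower = true := by decide

/-- Forbidden types of the pairwise-absorbing-bottoms face (`…MonomialFaceB`). [this work] -/
def forbAbsorbingBottoms : Ty → Bool := fun t =>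
  t ∈ [((0 : Fin 3), (0 : Fin 3), (1 : Fin 3)), (0, 1, 0), (1, 0, 0), (0, 1, 1), (1, 0, 1), (1, 1, 0), (0, 2, 2), (2, 0, 2), (2, 2, 0),
       (1, 2, 2), (2, 1, 2), (2, 2, 1)]

/-- The pairwise-absorbing-bottoms face passes the check. [this work] -/
theorem check_absorbingBottoms : check tpTerms forbAbsorbingBottoms = true := by decide

end TypeCert

end SahiTwoLevelVariational

end Summit.CriticalPhenomena.PercolationContinuityZ3.Theorems
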